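import Summits.QuantumAdvantage.QuantumAdvantage.Theorems.CubicForrelationNearExactIsExactCubicFormR4PartnerTools
import Summits.QuantumAdvantage.QuantumAdvantage.Theorems.CubicForrelationNearExactIsExactCubicFormR4Cells
import Summits.QuantumAdvantage.QuantumAdvantage.Theorems.CubicForrelationNearExactIsExactCubicFormPartnerTransport
import Summits.QuantumAdvantage.QuantumAdvantage.Theorems.CubicForrelationNearExactIsExactCubicFormLightCell
import Summits.QuantumAdvantage.QuantumAdvantage.Theorems.CubicForrelationNearExactIsExactCubicFormLightCoordsRead
import Summits.QuantumAdvantage.QuantumAdvantage.Theorems.CubicForrelationNearExactIsExactKtThreeStructure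
import Summits.QuantumAdvantage.QuantumAdvantage.Theorems.CubicForrelationNearExactIsExactTwelvePartnerLight

/-!
# Crux `CubicForrelation.NearExactIsExact` (stmt-QuantumAdvantage-14043) — E1280-even, R4 branch: the DISPATCH on the cells' cubic form
  `t̄₇ ∈ {0, T, x₁q₄}` (Kasami–Tokura on the lightest of the ten cells), the whole partner package transported into normal `z`-coordinates

Certificate seat `b2b-cforr-cert` (gen 42).  HONEST FRAMING: kernel-checked bookkeeping (standard axioms) — the R4 analogue of
…CubicFormR2PartnerHyperplane.  It reduces "no light cubic with a partnered cubic form has an R4 direction" (hypothesis `HR4` of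
`tpw_weight_ge_1280_of_branches`, after `tpw_R4_partner_frame`) to THREE explicit statements, the descendants of R4-PARTNER.md §1/§4–6:
* `HZ` (descendant `0`): the package in the adapted R4 frame with `wt < 1280` and `t̄₇ = 0` (`d` vanishes on `z × z × z`) is contradictory;
* `HL 1` (descendant `T`) and `HL 2` (descendant `x₁q₄ = Qf`): the package with `wt < 1280`, a lightest `Z₁₀`-cell `vc` of weight
  `32 − 2^(5−h)` (`16` resp. `24`) supported on the half-space `{s₀ = b}` and with third differences `u₀·ω(v,w) ⊕ v₀·ω(u,w) ⊕ w₀·ω(u,v)`,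
  `ω = Σ_{i<h} s_{1+i} ∧ s_{1+h+i}` (so `t̄₇ = s₀s₁s₂ = T` for `h = 1`, `t̄₇ = s₀(s₁s₃ + s₂s₄) = Qf` for `h = 2`; coordinates of `Fin 7` through
  `Fin.castLE hk`, `hk : 1+h+h ≤ 7`), is contradictory.
PROOF of the dispatch (`tpw_R4_dispatch_of_branches`): `wt κ = 768 + 2·Σ_{Z₁₀} wt f_v` (`tc5_weight`) and `wt κ < 1280` give
`Σ_{Z₁₀} wt f_v ≤ 255`, so a lightest cell `vc ∈ Z₁₀` has `wt f_vc ≤ 25`; if `wt f_vc = 0` the shared cubic form on `z` vanishes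
(`tc5_third_rho_unit`) ⇒ `HZ`; else Kasami–Tokura (`kt3_structure`, `4·25 < 128`, the exceptional `28` excluded) puts `supp f_vc` in a
hyperplane, `tlc_light_frame` pins `4·wt + 2^(7−h) = 128` with `h ∈ {1,2}` (`wt ≤ 25`), `tpw_light_coords` gives normal coordinates `P` on the
`z`-block, and the block frame `1₅ ⊕ P` (`tbk_block_frame`) transports the package (`tpw_partner_transport`; frame identity by
`tpw_R4_block_frame_identity`, `hF` by `tpw_R4_hF_of_frame_identity`, symmetries of `d` by `tpw_d_symm`, cells/weights by `tct_card_comp`,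
third differences by `tct_third_comp`) ⇒ `HL h`.  `HZ`, `HL 1`, `HL 2` remain TO BE PROVED (R4-PARTNER §3–6: dimension lemma (★), menus
(M0)/(MT)/(MQ), `Z₁₀` combinatorics, leaves RZ / radical).  Nothing about `θ₁₂`; NOT summit progress.

References: this seat lineage (g37 R4-PARTNER §1–2, g39 HANDPROOFS §2, g40–41 tools); T. Kasami, N. Tokura (1970) Thm 1.
Axioms: the standard three.
-/

set_option linter.dupNamespace false -- D-0017: single-problem summit ⇒ `QuantumAdvantage.QuantumAdvantage` by design

namespace Summit.QuantumAdvantage.QuantumAdvantage.Theorems.CubicForrelation.NearExactIsExact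

open Finset
open Literature.Computability.QuantumComplexity
open Literature.Computability.QuantumComplexity.BuzetChailloux (bxor zeroVec bxor_comm bxor_self bxor_zeroVec zeroVec_bxor
  bxor_bxor_cancel_left)

/-- **R4 dispatch.**  If the three descendants are contradictory — `HZ` (`t̄₇ = 0`), `HL 1` (`t̄₇ = T`, lightest cell of weight `16` on a
half-space, in normal coordinates) and `HL 2` (`t̄₇ = Qf`, weight `24`) — then so is every adapted-R4-frame partner package
(`tpw_R4_partner_frame`) of weight `< 1280`.  See the module docstring for the proof. [this work; cite: KasamiTokura1970, Thm 1] -/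
theorem tpw_R4_dispatch_of_branches
    (HZ :
      ∀ (κ : (Fin (5 + 7) → Bool) → Bool), IsDegLeFun 3 κ →
      ∀ (c d : Fin (5 + 7) → Fin (5 + 7) → Fin (5 + 7) → ZMod 2),
      (∀ p j k, c p k j = c p j k) → (∀ p j k, c j p k = c p j k) → (∀ p j, c p j j = 0) →
      (∀ φ j k, d φ k j = d φ j k) → (∀ φ j k, d j φ k = d φ j k) → (∀ φ j, d φ j j = 0) →
      (∀ φ j k, d φ j k =
        if ((((κ zeroVec ^^ κ (bxor zeroVec (fun l => decide (l = k)))) ^^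
                (κ (bxor zeroVec (fun l => decide (l = j))) ^^ κ (bxor (bxor zeroVec (fun l => decide (l = j))) (fun l => decide (l = k))))) ^^
              ((κ (bxor zeroVec (fun l => decide (l = φ))) ^^ κ (bxor (bxor zeroVec (fun l => decide (l = φ))) (fun l => decide (l = k)))) ^^
                (κ (bxor (bxor zeroVec (fun l => decide (l = φ))) (fun l => decide (l = j))) ^^
                  κ (bxor (bxor (bxor zeroVec (fun l => decide (l = φ))) (fun l => decide (l = j))) (fun l => decide (l = k))))))) = true
        then 1 else 0) →
      (∀ p φ, (∑ j, ∑ k, (if j < k then c p j k * d φ j k else 0)) = if p = φ then 1 else 0) →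
      (∀ y, (κ y ^^ κ (bxor y (fun l => decide (l = Fin.castAdd 7 (0 : Fin 5))))) =
        ((y (Fin.castAdd 7 (1 : Fin 5)) && y (Fin.castAdd 7 (2 : Fin 5))) ^^ (y (Fin.castAdd 7 (3 : Fin 5)) && y (Fin.castAdd 7 (4 : Fin 5))))) →
      (∀ j k, d (Fin.castAdd 7 (0 : Fin 5)) j k =
        (if (j = Fin.castAdd 7 (1 : Fin 5) ∧ k = Fin.castAdd 7 (2 : Fin 5)) ∨ (j = Fin.castAdd 7 (2 : Fin 5) ∧ k = Fin.castAdd 7 (1 : Fin 5)) then 1 else 0) +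
        (if (j = Fin.castAdd 7 (3 : Fin 5) ∧ k = Fin.castAdd 7 (4 : Fin 5)) ∨ (j = Fin.castAdd 7 (4 : Fin 5) ∧ k = Fin.castAdd 7 (3 : Fin 5)) then 1 else 0)) →
      #(univ.filter fun y : Fin (5 + 7) → Bool => κ y = true) < 1280 →
      (∀ σ τ υ : Fin 7, d (Fin.natAdd 5 σ) (Fin.natAdd 5 τ) (Fin.natAdd 5 υ) = 0) → False)
    (HL : ∀ (h : ℕ), ∀ (hk : 1 + h + h ≤ 7), 1 ≤ h → h ≤ 2 →
      ∀ (κ : (Fin (5 + 7) → Bool) → Bool), IsDegLeFun 3 κ →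
      ∀ (c d : Fin (5 + 7) → Fin (5 + 7) → Fin (5 + 7) → ZMod 2),
      (∀ p j k, c p k j = c p j k) → (∀ p j k, c j p k = c p j k) → (∀ p j, c p j j = 0) →
      (∀ φ j k, d φ k j = d φ j k) → (∀ φ j k, d j φ k = d φ j k) → (∀ φ j, d φ j j = 0) →
      (∀ φ j k, d φ j k =
        if ((((κ zeroVec ^^ κ (bxor zeroVec (fun l => decide (l = k)))) ^^
                (κ (bxor zeroVec (fun l => decide (l = j))) ^^ κ (bxor (bxor zeroVec (fun l => decide (l = j))) (fun l => decide (l = k))))) ^^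
              ((κ (bxor zeroVec (fun l => decide (l = φ))) ^^ κ (bxor (bxor zeroVec (fun l => decide (l = φ))) (fun l => decide (l = k)))) ^^
                (κ (bxor (bxor zeroVec (fun l => decide (l = φ))) (fun l => decide (l = j))) ^^
                  κ (bxor (bxor (bxor zeroVec (fun l => decide (l = φ))) (fun l => decide (l = j))) (fun l => decide (l = k))))))) = true
        then 1 else 0) →
      (∀ p φ, (∑ j, ∑ k, (if j < k then c p j k * d φ j k else 0)) = if p = φ then 1 else 0) →
      (∀ y, (κ y ^^ κ (bxor y (fun l => decide (l = Fin.castAdd 7 (0 : Fin 5))))) =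
        ((y (Fin.castAdd 7 (1 : Fin 5)) && y (Fin.castAdd 7 (2 : Fin 5))) ^^ (y (Fin.castAdd 7 (3 : Fin 5)) && y (Fin.castAdd 7 (4 : Fin 5))))) →
      (∀ j k, d (Fin.castAdd 7 (0 : Fin 5)) j k =
        (if (j = Fin.castAdd 7 (1 : Fin 5) ∧ k = Fin.castAdd 7 (2 : Fin 5)) ∨ (j = Fin.castAdd 7 (2 : Fin 5) ∧ k = Fin.castAdd 7 (1 : Fin 5)) then 1 else 0) +
        (if (j = Fin.castAdd 7 (3 : Fin 5) ∧ k = Fin.castAdd 7 (4 : Fin 5)) ∨ (j = Fin.castAdd 7 (4 : Fin 5) ∧ k = Fin.castAdd 7 (3 : Fin 5)) then 1 else 0)) →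
      #(univ.filter fun y : Fin (5 + 7) → Bool => κ y = true) < 1280 →
      ∀ (vc : Fin 4 → Bool), ((vc 0 && vc 1) ^^ (vc 2 && vc 3)) = false →
      (∀ v' : Fin 4 → Bool, ((v' 0 && v' 1) ^^ (v' 2 && v' 3)) = false →
        #(univ.filter fun s : Fin 7 → Bool => κ (Fin.append (Matrix.vecCons false vc) s) = true) ≤
          #(univ.filter fun s : Fin 7 → Bool => κ (Fin.append (Matrix.vecCons false v') s) = true)) →
      4 * #(univ.filter fun s : Fin 7 → Bool => κ (Fin.append (Matrix.vecCons false vc) s) = true) + 2 ^ (7 - h) = 2 ^ 7 →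
      ∀ (bz : Bool), (∀ s : Fin 7 → Bool, κ (Fin.append (Matrix.vecCons false vc) s) = true → s (Fin.castLE hk (Fin.castAdd h (Fin.castAdd h (0 : Fin 1)))) = bz) →
      (∀ u v w x : Fin 7 → Bool,
        ((((κ (Fin.append (Matrix.vecCons false vc) x) ^^ κ (Fin.append (Matrix.vecCons false vc) (bxor x w))) ^^
              (κ (Fin.append (Matrix.vecCons false vc) (bxor x v)) ^^ κ (Fin.append (Matrix.vecCons false vc) (bxor (bxor x v) w)))) ^^
            ((κ (Fin.append (Matrix.vecCons false vc) (bxor x u)) ^^ κ (Fin.append (Matrix.vecCons false vc) (bxor (bxor x u) w))) ^^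
              (κ (Fin.append (Matrix.vecCons false vc) (bxor (bxor x u) v)) ^^
                κ (Fin.append (Matrix.vecCons false vc) (bxor (bxor (bxor x u) v) w)))))) =
        ((((u (Fin.castLE hk (Fin.castAdd h (Fin.castAdd h (0 : Fin 1)))) &&
            decide ((∑ ii : Fin h, ((if v (Fin.castLE hk (Fin.castAdd h (Fin.natAdd 1 ii))) = true then (1 : ZMod 2) else 0) * (if w (Fin.castLE hk (Fin.natAdd (1 + h) ii)) = true then (1 : ZMod 2) else 0) +
              (if v (Fin.castLE hk (Fin.natAdd (1 + h) ii)) = true then (1 : ZMod 2) else 0) * (if w (Fin.castLE hk (Fin.castAdd h (Fin.natAdd 1 ii))) = true then (1 : ZMod 2) else 0))) = 1)) ^^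
          (v (Fin.castLE hk (Fin.castAdd h (Fin.castAdd h (0 : Fin 1)))) &&
            decide ((∑ ii : Fin h, ((if u (Fin.castLE hk (Fin.castAdd h (Fin.natAdd 1 ii))) = true then (1 : ZMod 2) else 0) * (if w (Fin.castLE hk (Fin.natAdd (1 + h) ii)) = true then (1 : ZMod 2) else 0) +
              (if u (Fin.castLE hk (Fin.natAdd (1 + h) ii)) = true then (1 : ZMod 2) else 0) * (if w (Fin.castLE hk (Fin.castAdd h (Fin.natAdd 1 ii))) = true then (1 : ZMod 2) else 0))) = 1))) ^^
          (w (Fin.castLE hk (Fin.castAdd h (Fin.castAdd h (0 : Fin 1)))) &&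
            decide ((∑ ii : Fin h, ((if u (Fin.castLE hk (Fin.castAdd h (Fin.natAdd 1 ii))) = true then (1 : ZMod 2) else 0) * (if v (Fin.castLE hk (Fin.natAdd (1 + h) ii)) = true then (1 : ZMod 2) else 0) +
              (if u (Fin.castLE hk (Fin.natAdd (1 + h) ii)) = true then (1 : ZMod 2) else 0) * (if v (Fin.castLE hk (Fin.castAdd h (Fin.natAdd 1 ii))) = true then (1 : ZMod 2) else 0))) = 1))))) → False) :

    ∀ (κ : (Fin (5 + 7) → Bool) → Bool), IsDegLeFun 3 κ →
    ∀ (c d : Fin (5 + 7) → Fin (5 + 7) → Fin (5 + 7) → ZMod 2),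
    (∀ p j k, c p k j = c p j k) → (∀ p j k, c j p k = c p j k) → (∀ p j, c p j j = 0) →
    (∀ φ j k, d φ k j = d φ j k) → (∀ φ j k, d j φ k = d φ j k) → (∀ φ j, d φ j j = 0) →
    (∀ φ j k, d φ j k =
      if ((((κ zeroVec ^^ κ (bxor zeroVec (fun l => decide (l = k)))) ^^
              (κ (bxor zeroVec (fun l => decide (l = j))) ^^ κ (bxor (bxor zeroVec (fun l => decide (l = j))) (fun l => decide (l = k))))) ^^
            ((κ (bxor zeroVec (fun l => decide (l = φ))) ^^ κ (bxor (bxor zeroVec (fun l => decide (l = φ))) (fun l => decide (l = k)))) ^^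
              (κ (bxor (bxor zeroVec (fun l => decide (l = φ))) (fun l => decide (l = j))) ^^
                κ (bxor (bxor (bxor zeroVec (fun l => decide (l = φ))) (fun l => decide (l = j))) (fun l => decide (l = k))))))) = true
      then 1 else 0) →
    (∀ p φ, (∑ j, ∑ k, (if j < k then c p j k * d φ j k else 0)) = if p = φ then 1 else 0) →
    (∀ y, (κ y ^^ κ (bxor y (fun l => decide (l = Fin.castAdd 7 (0 : Fin 5))))) =
      ((y (Fin.castAdd 7 (1 : Fin 5)) && y (Fin.castAdd 7 (2 : Fin 5))) ^^ (y (Fin.castAdd 7 (3 : Fin 5)) && y (Fin.castAdd 7 (4 : Fin 5))))) →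
    (∀ j k, d (Fin.castAdd 7 (0 : Fin 5)) j k =
      (if (j = Fin.castAdd 7 (1 : Fin 5) ∧ k = Fin.castAdd 7 (2 : Fin 5)) ∨ (j = Fin.castAdd 7 (2 : Fin 5) ∧ k = Fin.castAdd 7 (1 : Fin 5)) then 1 else 0) +
      (if (j = Fin.castAdd 7 (3 : Fin 5) ∧ k = Fin.castAdd 7 (4 : Fin 5)) ∨ (j = Fin.castAdd 7 (4 : Fin 5) ∧ k = Fin.castAdd 7 (3 : Fin 5)) then 1 else 0)) →
    #(univ.filter fun y : Fin (5 + 7) → Bool => κ y = true) < 1280 →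
    False := by
  intro κ hκ c d hcs hcc hcd hds hdc hdd hd hpair hD hF hlt
  -- the cells and the weight identity
  have hcub : ∀ w : Fin 5 → Bool, IsDegLeFun 3 (fun s : Fin 7 → Bool => κ (Fin.append w s)) :=
    fun w => tc5_rho_isDegLeFun κ hκ w
  have hwt := tc5_weight κ hD
  -- a lightest cell of `Z₁₀`
  obtain ⟨vc, hvcZ, hmin⟩ := Finset.exists_min_image
    (univ.filter fun v : Fin 4 → Bool => ((v 0 && v 1) ^^ (v 2 && v 3)) = false)
    (fun v => #(univ.filter fun s : Fin 7 → Bool => κ (Fin.append (Matrix.vecCons false v) s) = true)) ⟨fun _ => false, by simp⟩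
  have hQ : ((vc 0 && vc 1) ^^ (vc 2 && vc 3)) = false := (mem_filter.mp hvcZ).2
  have hmin' : ∀ v' : Fin 4 → Bool, ((v' 0 && v' 1) ^^ (v' 2 && v' 3)) = false →
      #(univ.filter fun s : Fin 7 → Bool => κ (Fin.append (Matrix.vecCons false vc) s) = true) ≤
        #(univ.filter fun s : Fin 7 → Bool => κ (Fin.append (Matrix.vecCons false v') s) = true) :=
    fun v' hv' => hmin v' (mem_filter.mpr ⟨mem_univ _, hv'⟩)
  have h25 : #(univ.filter fun s : Fin 7 → Bool => κ (Fin.append (Matrix.vecCons false vc) s) = true) ≤ 25 := by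
    have l0 := hmin' ![false, false, false, false] rfl
    have l1 := hmin' ![false, false, false, true] rfl
    have l2 := hmin' ![false, false, true, false] rfl
    have l3 := hmin' ![false, true, false, false] rfl
    have l4 := hmin' ![false, true, false, true] rfl
    have l5 := hmin' ![false, true, true, false] rfl
    have l6 := hmin' ![true, false, false, false] rfl
    have l7 := hmin' ![true, false, false, true] rfl
    have l8 := hmin' ![true, false, true, false] rfl
    have l9 := hmin' ![true, true, true, true] rfl
    norm_num at hwt
    omega
  by_cases hzero : #(univ.filter fun s : Fin 7 → Bool => κ (Fin.append (Matrix.vecCons false vc) s) = true) = 0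
  · -- the lightest cell is identically zero: `t̄₇ = 0`
    have hz : ∀ s : Fin 7 → Bool, κ (Fin.append (Matrix.vecCons false vc) s) = false := by
      intro s
      cases hks : κ (Fin.append (Matrix.vecCons false vc) s)
      · rfl
      · exfalso
        have hmem : s ∈ (univ.filter fun s : Fin 7 → Bool => κ (Fin.append (Matrix.vecCons false vc) s) = true) :=
          mem_filter.mpr ⟨mem_univ _, hks⟩
        rw [Finset.card_eq_zero.mp hzero] at hmem
        exact Finset.notMem_empty s hmem
    refine HZ κ hκ c d hcs hcc hcd hds hdc hdd hd hpair hD hF hlt (fun σ τ υ => ?_)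
    have h3 := tc5_third_rho_unit κ hκ (Matrix.vecCons false vc) σ τ υ zeroVec zeroVec
    dsimp only at h3
    rw [hd (Fin.natAdd 5 σ) (Fin.natAdd 5 τ) (Fin.natAdd 5 υ), ← h3]
    simp only [hz, Bool.xor_false]
    rfl
  · have hpos : 0 < #(univ.filter fun s : Fin 7 → Bool => κ (Fin.append (Matrix.vecCons false vc) s) = true) := Nat.pos_of_ne_zero hzero
    have hρ := hcub (Matrix.vecCons false vc)
    have h4 : 4 * #(univ.filter fun s : Fin 7 → Bool => κ (Fin.append (Matrix.vecCons false vc) s) = true) < 2 ^ 7 := by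
      norm_num; omega
    rcases kt3_structure (fun s : Fin 7 → Bool => κ (Fin.append (Matrix.vecCons false vc) s)) hρ hpos h4 with
      ⟨z, bz, hz, hsupp⟩ | hexc
    swap
    · exfalso; norm_num at hexc; omega
    -- the light cell's frame and coordinates
    obtain ⟨vv, h, bb, cc, hrest⟩ :=
      tlc_light_frame (fun s : Fin 7 → Bool => κ (Fin.append (Matrix.vecCons false vc) s)) hρ z hz bz hsupp
    dsimp only at hrest
    obtain ⟨hvz, -, -, hB, f1, f2, f3, f4, fmax, hbz, hcz, hrad, h2n, hwt3⟩ := hrest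
    obtain ⟨hk, P, Pi, hPPi, hPiP, hPz, hform⟩ := tpw_light_coords (fun s : Fin 7 → Bool => κ (Fin.append (Matrix.vecCons false vc) s))
      hρ z vv bz hsupp hvz
      (fun x => κ (Fin.append (Matrix.vecCons false vc) x) ^^ κ (Fin.append (Matrix.vecCons false vc) (bxor x vv))) (fun x => rfl)
      _ hB h bb cc f1 f2 f3 f4 fmax hbz hcz hrad
    -- the weight pins `h ∈ {1, 2}`
    have e1 : 4 * #(univ.filter fun s : Fin 7 → Bool => κ (Fin.append (Matrix.vecCons false vc) s) = true) + 2 ^ (7 - h) = 2 ^ 7 := by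
      rcases hwt3 with e | e | e
      · exact e
      · omega
      · have : 0 < 2 ^ (7 - h) := Nat.two_pow_pos (7 - h)
        omega
    have h1 : 1 ≤ h := by
      rcases Nat.eq_zero_or_pos h with h0 | hp
      · subst h0
        norm_num at e1
        omega
      · exact hp
    have h2 : h ≤ 2 := by
      by_contra hh
      have h3 : h = 3 := by omega
      subst h3
      norm_num at e1
      omega
    -- block frame `1₅ ⊕ P` and transport of the package
    obtain ⟨L, Li, hLLi, hLiL, hLapp, -, hyy, hys, hsy, -⟩ := tbk_block_frame (k := 5) P Pi hPPi hPiP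
    obtain ⟨κ', c', d', hκap, -, -, hκ'3, hcard', hcs', hcc', hcd', hd'T, hpair'⟩ :=
      tpw_partner_transport κ hκ c d hcs hcc hcd hds hdd hd hpair L Li hLLi hLiL zeroVec
    have hD' : ∀ y, (κ' y ^^ κ' (bxor y (fun l => decide (l = Fin.castAdd 7 (0 : Fin 5))))) =
        ((y (Fin.castAdd 7 (1 : Fin 5)) && y (Fin.castAdd 7 (2 : Fin 5))) ^^
          (y (Fin.castAdd 7 (3 : Fin 5)) && y (Fin.castAdd 7 (4 : Fin 5)))) := fun y => by
      rw [hκap, hκap]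
      exact tpw_R4_block_frame_identity κ L hyy hys hsy hD zeroVec rfl rfl rfl rfl y
    have hF' := tpw_R4_hF_of_frame_identity κ' d' hd'T hD'
    obtain ⟨hds', hdc', hdd'⟩ := tpw_d_symm κ' d' hd'T
    -- the cells of `κ'` are the cells of `κ` composed with `P`
    have hcell : ∀ (w : Fin 5 → Bool) (s : Fin 7 → Bool), κ' (Fin.append w s) =
        κ (Fin.append w (fun σ => decide ((∑ σ', P σ σ' * (if s σ' = true then (1 : ZMod 2) else 0)) = 1))) := by
      intro w s
      rw [hκap, hLapp w s, zeroVec_bxor]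
    have hW : ∀ w : Fin 5 → Bool, #(univ.filter fun s : Fin 7 → Bool => κ' (Fin.append w s) = true) =
        #(univ.filter fun s : Fin 7 → Bool => κ (Fin.append w s) = true) := by
      intro w
      have e := tct_card_comp P Pi hPPi hPiP zeroVec (fun s : Fin 7 → Bool => κ (Fin.append w s) = true)
      simp only [zeroVec_bxor] at e
      simp only [hcell]
      exact e
    have hlt' : #(univ.filter fun y : Fin (5 + 7) → Bool => κ' y = true) < 1280 := by rw [hcard']; exact hlt
    have hmin'' : ∀ v' : Fin 4 → Bool, ((v' 0 && v' 1) ^^ (v' 2 && v' 3)) = false →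
        #(univ.filter fun s : Fin 7 → Bool => κ' (Fin.append (Matrix.vecCons false vc) s) = true) ≤
          #(univ.filter fun s : Fin 7 → Bool => κ' (Fin.append (Matrix.vecCons false v') s) = true) := fun v' hv' => by
      rw [hW, hW]; exact hmin' v' hv'
    have hwt' : 4 * #(univ.filter fun s : Fin 7 → Bool => κ' (Fin.append (Matrix.vecCons false vc) s) = true) + 2 ^ (7 - h) = 2 ^ 7 := by
      rw [hW]; exact e1
    -- the supporting hyperplane becomes `s₀ = bz`
    have hsupp' : ∀ s : Fin 7 → Bool, κ' (Fin.append (Matrix.vecCons false vc) s) = true →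
        s (Fin.castLE hk (Fin.castAdd h (Fin.castAdd h (0 : Fin 1)))) = bz := by
      intro s hs
      rw [hcell] at hs
      have e := hsupp _ hs
      rw [hPz s] at e
      exact e
    -- the cubic form of the light cell in the new coordinates
    have hT' : (∀ u v w x : Fin 7 → Bool,
        ((((κ' (Fin.append (Matrix.vecCons false vc) x) ^^ κ' (Fin.append (Matrix.vecCons false vc) (bxor x w))) ^^
              (κ' (Fin.append (Matrix.vecCons false vc) (bxor x v)) ^^ κ' (Fin.append (Matrix.vecCons false vc) (bxor (bxor x v) w)))) ^^
            ((κ' (Fin.append (Matrix.vecCons false vc) (bxor x u)) ^^ κ' (Fin.append (Matrix.vecCons false vc) (bxor (bxor x u) w))) ^^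
              (κ' (Fin.append (Matrix.vecCons false vc) (bxor (bxor x u) v)) ^^
                κ' (Fin.append (Matrix.vecCons false vc) (bxor (bxor (bxor x u) v) w)))))) =
        ((((u (Fin.castLE hk (Fin.castAdd h (Fin.castAdd h (0 : Fin 1)))) &&
            decide ((∑ ii : Fin h, ((if v (Fin.castLE hk (Fin.castAdd h (Fin.natAdd 1 ii))) = true then (1 : ZMod 2) else 0) * (if w (Fin.castLE hk (Fin.natAdd (1 + h) ii)) = true then (1 : ZMod 2) else 0) +
              (if v (Fin.castLE hk (Fin.natAdd (1 + h) ii)) = true then (1 : ZMod 2) else 0) * (if w (Fin.castLE hk (Fin.castAdd h (Fin.natAdd 1 ii))) = true then (1 : ZMod 2) else 0))) = 1)) ^^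
          (v (Fin.castLE hk (Fin.castAdd h (Fin.castAdd h (0 : Fin 1)))) &&
            decide ((∑ ii : Fin h, ((if u (Fin.castLE hk (Fin.castAdd h (Fin.natAdd 1 ii))) = true then (1 : ZMod 2) else 0) * (if w (Fin.castLE hk (Fin.natAdd (1 + h) ii)) = true then (1 : ZMod 2) else 0) +
              (if u (Fin.castLE hk (Fin.natAdd (1 + h) ii)) = true then (1 : ZMod 2) else 0) * (if w (Fin.castLE hk (Fin.castAdd h (Fin.natAdd 1 ii))) = true then (1 : ZMod 2) else 0))) = 1))) ^^
          (w (Fin.castLE hk (Fin.castAdd h (Fin.castAdd h (0 : Fin 1)))) &&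
            decide ((∑ ii : Fin h, ((if u (Fin.castLE hk (Fin.castAdd h (Fin.natAdd 1 ii))) = true then (1 : ZMod 2) else 0) * (if v (Fin.castLE hk (Fin.natAdd (1 + h) ii)) = true then (1 : ZMod 2) else 0) +
              (if u (Fin.castLE hk (Fin.natAdd (1 + h) ii)) = true then (1 : ZMod 2) else 0) * (if v (Fin.castLE hk (Fin.castAdd h (Fin.natAdd 1 ii))) = true then (1 : ZMod 2) else 0))) = 1))))) := by
      intro u v w x
      have h3 := tct_third_comp (fun s : Fin 7 → Bool => κ (Fin.append (Matrix.vecCons false vc) s)) P zeroVec u v w x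
      dsimp only at h3
      simp only [zeroVec_bxor] at h3
      have hf := hform u v w (fun σ => decide ((∑ σ', P σ σ' * (if x σ' = true then (1 : ZMod 2) else 0)) = 1))
      dsimp only at hf
      simp only [hcell]
      rw [h3]
      exact hf
    exact HL h hk h1 h2 κ' hκ'3 c' d' hcs' hcc' hcd' hds' hdc' hdd' hd'T hpair' hD' hF' hlt' vc hQ hmin'' hwt' bz hsupp' hT'

end Summit.QuantumAdvantage.QuantumAdvantage.Theorems.CubicForrelation.NearExactIsExact
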